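import Summits.CriticalPhenomena.CardyFormulaZ2.Theorems.CardyIKTransportIKLinearTransportLine
import Literature.Probability.Percolation.TriHexLemma
import Literature.Probability.Percolation.RSW

/-!
# `IKQuarterTurn` (route `CardyIKTransport`, stmt-CriticalPhenomena-10900), part 1: the bit bijection
# realising the quarter-turn of the isotropic Izergin–Korepin gauge

Support file for the item `CardyIKTransport.IKQuarterTurn` (closed in
`Theorems/CardyIKTransportIKQuarterTurn.lean`). Write `ω = (A, B, Π, Π', C)` for the five bit fields
(row signs, column signs, biased plaquettes, unused fair plaquettes, diagonal coins) of the gauge space `Ω`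
of `Theorems/CardyIKTransportIKLinearTransportLine.lean` (vocabulary `μIK`, `obs`, `blackSet`, `antiSet`
reused). Let `rot v = (-v₁, v₀)` be the quarter-turn of `ℤ²` and `faceRot f = (-f₁ - 1, f₀)` the induced
map on faces (lower-left corners). The bit map
`Φ (A, B, Π, Π', C) = (c + B ∘ neg, c + A, faceRot '' Π, Π', (faceRot '' C)ᶜ)`, `c = A 0 ⊕ B 0`
(`c + X` = `Xᶜ` if `c` else `X`), is a measurable bijection of `Ω` (`Φ : Ω ≃ᵐ Ω`) preserving the product
law `μIK` (`measurePreserving_Φ`: swap / relabelling / complement invariance of the fair fields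
`setBer(univ, ½)`, relabelling invariance of the biased plaquette field, and the piecewise-complement lemma
`measurePreserving_piecewise`), and it carries the black cells to their `rot`-image and the anti-diagonal
faces to the complement of their `faceRot`-image (`obs_Φ`; the plaquette count in the rectangle between `0`
and `v` is carried to that between `0` and `rot v`, `cnt_preimage_faceRot`). Elementary; no literature
fact is used (the route file `Theses/CardyIKTransport.lean`, item 10900, sketches this bijection).
-/

noncomputable section

namespace Summit.CriticalPhenomena.CardyFormulaZ2.Theorems.IKQuarterTurn

open scoped Classical
open MeasureTheory Filter Topology Set
open Literature.Probability.Percolation Literature.Probability.LatticeModels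
open Literature.Probability.RandomPlanarGeometry
open Summit.CriticalPhenomena.CardyFormulaZ2.Theorems.IKLinearTransport.PinnedDiagramExchange

/-! ## §1 The quarter-turn of `ℤ²` and the induced map on faces -/

/-- The quarter-turn `v ↦ (-v₁, v₀)` of `ℤ²` (so that `sqEmb (rot v) = I * sqEmb v`). [folklore] -/
def rot : Site 2 ≃ Site 2 where
  toFun v := ![-(v 1), v 0]
  invFun v := ![v 1, -(v 0)]
  left_inv v := by ext i; fin_cases i <;> simp
  right_inv v := by ext i; fin_cases i <;> simp

/-- First coordinate of `rot v`. [folklore] -/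
@[simp] theorem rot_apply_zero (v : Site 2) : rot v 0 = -(v 1) := rfl

/-- Second coordinate of `rot v`. [folklore] -/
@[simp] theorem rot_apply_one (v : Site 2) : rot v 1 = v 0 := rfl

/-- First coordinate of `rot⁻¹ v = (v₁, -v₀)`. [folklore] -/
@[simp] theorem rot_symm_apply_zero (v : Site 2) : rot.symm v 0 = v 1 := rfl

/-- Second coordinate of `rot⁻¹ v = (v₁, -v₀)`. [folklore] -/
@[simp] theorem rot_symm_apply_one (v : Site 2) : rot.symm v 1 = -(v 0) := rfl

/-- The map induced by `rot` on faces labelled by their lower-left corner: the unit square at `f` is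
carried by `rot` onto the unit square at `(-f₁ - 1, f₀)`. [folklore] -/
def faceRot : Site 2 ≃ Site 2 where
  toFun f := ![-(f 1) - 1, f 0]
  invFun f := ![f 1, -(f 0) - 1]
  left_inv f := by ext i; fin_cases i <;> simp
  right_inv f := by ext i; fin_cases i <;> simp

/-- First coordinate of `faceRot⁻¹ f = (f₁, -f₀ - 1)`. [folklore] -/
@[simp] theorem faceRot_symm_apply_zero (f : Site 2) : faceRot.symm f 0 = f 1 := rfl

/-- Second coordinate of `faceRot⁻¹ f = (f₁, -f₀ - 1)`. [folklore] -/
@[simp] theorem faceRot_symm_apply_one (f : Site 2) : faceRot.symm f 1 = -(f 0) - 1 := rfl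

/-! ## §2 A piecewise measure-preserving lemma -/

/-- If `κ` preserves `μ` and leaves the measurable set `E` invariant, then the map equal to `κ` on `E`
and to the identity off `E` preserves `μ`. [folklore] -/
theorem measurePreserving_piecewise {α : Type*} [MeasurableSpace α] {μ : Measure α} {κ : α → α}
    {E : Set α} [DecidablePred (· ∈ E)] (hκ : MeasurePreserving κ μ μ) (hE : MeasurableSet E)
    (hinv : κ ⁻¹' E = E) : MeasurePreserving (E.piecewise κ id) μ μ := by
  have hm : Measurable (E.piecewise κ id) := hκ.measurable.piecewise hE measurable_id
  refine ⟨hm, Measure.ext fun s hs => ?_⟩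
  rw [Measure.map_apply hm hs, Set.piecewise_preimage]
  change μ (κ ⁻¹' s ∩ E ∪ id ⁻¹' s \ E) = μ s
  have hdisj : Disjoint (κ ⁻¹' s ∩ E) (id ⁻¹' s \ E) :=
    Set.disjoint_left.2 fun x hx hx' => hx'.2 hx.2
  rw [measure_union hdisj (hs.diff hE), Set.preimage_id_eq, id, ← hinv, ← Set.preimage_inter, hinv,
    hκ.measure_preimage (hs.inter hE).nullMeasurableSet, measure_inter_add_sdiff s hE]

/-! ## §3 The bit bijection `Φ` -/

/-- Pairs of sign sequences of odd total parity at the origin: `A 0 ⊕ B 0 = 1`. [folklore] -/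
def oddPairs : Set (Set ℤ × Set ℤ) := {x | Xor ((0 : ℤ) ∈ x.1) ((0 : ℤ) ∈ x.2)}

/-- `oddPairs` is measurable. [folklore] -/
theorem measurableSet_oddPairs : MeasurableSet oddPairs := by
  have h1 : Measurable fun x : Set ℤ × Set ℤ => (0 : ℤ) ∈ x.1 :=
    (measurable_set_mem 0).comp measurable_fst
  have h2 : Measurable fun x : Set ℤ × Set ℤ => (0 : ℤ) ∈ x.2 :=
    (measurable_set_mem 0).comp measurable_snd
  exact measurableSet_setOf.2 ((h1.and h2.not).or (h2.and h1.not))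

/-- Complementing both sequences leaves `oddPairs` invariant. [folklore] -/
theorem preimage_compl_oddPairs : Prod.map compl compl ⁻¹' oddPairs = oddPairs := by
  ext x
  simp only [oddPairs, mem_preimage, mem_setOf_eq, Prod.map_fst, Prod.map_snd, mem_compl_iff,
    xor_not_not]

/-- The sign flip: complement both sign sequences when `A 0 ⊕ B 0 = 1`. [folklore] -/
def flipPair : Set ℤ × Set ℤ → Set ℤ × Set ℤ := oddPairs.piecewise (Prod.map compl compl) id

/-- `flipPair` is an involution. [folklore] -/
theorem flipPair_involutive : Function.Involutive flipPair := by
  intro x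
  by_cases hx : x ∈ oddPairs
  · have hx' : Prod.map compl compl x ∈ oddPairs := by
      rw [← mem_preimage, preimage_compl_oddPairs]; exact hx
    rw [flipPair, piecewise_eq_of_mem _ _ _ hx, piecewise_eq_of_mem _ _ _ hx']
    exact Prod.ext (by simp only [Prod.map_fst, compl_compl]) (by simp only [Prod.map_snd, compl_compl])
  · rw [flipPair, piecewise_eq_of_notMem _ _ _ hx, id_eq, piecewise_eq_of_notMem _ _ _ hx, id_eq]

/-- `flipPair` is measurable. [folklore] -/
theorem measurable_flipPair : Measurable flipPair :=
  Measurable.piecewise measurableSet_oddPairs (measurable_compl.prodMap measurable_compl) measurable_id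

/-- The fair sign law `setBer(univ, ½)` on `ℤ` is complement invariant. [folklore] -/
theorem measurePreserving_compl_int :
    MeasurePreserving (compl : Set ℤ → Set ℤ) (sitePercolation ℤ half) (sitePercolation ℤ half) :=
  ⟨measurable_compl, by rw [sitePercolation_map_compl, symm_half]⟩

/-- `flipPair` preserves the pair of fair sign laws. [folklore] -/
theorem measurePreserving_flipPair :
    MeasurePreserving flipPair ((sitePercolation ℤ half).prod (sitePercolation ℤ half))
      ((sitePercolation ℤ half).prod (sitePercolation ℤ half)) :=
  measurePreserving_piecewise (measurePreserving_compl_int.prod measurePreserving_compl_int)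
    measurableSet_oddPairs preimage_compl_oddPairs

/-- `flipPair` as a measurable equivalence. [folklore] -/
def flipEquiv : Set ℤ × Set ℤ ≃ᵐ Set ℤ × Set ℤ :=
  MeasurableEquiv.ofInvolutive flipPair flipPair_involutive measurable_flipPair

/-- The sign part of `Φ`: `(A, B) ↦ flipPair (B ∘ neg, A)`. [folklore] -/
def ΦAB : Set ℤ × Set ℤ ≃ᵐ Set ℤ × Set ℤ :=
  (MeasurableEquiv.prodComm.trans
    (MeasurableEquiv.prodCongr (SiteConfig.relabel (Equiv.neg ℤ)) (MeasurableEquiv.refl (Set ℤ)))).trans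
    flipEquiv

/-- Relabelling invariance of site percolation, as a `MeasurePreserving` statement. [folklore] -/
theorem measurePreserving_relabel {V W : Type*} (e : V ≃ W) (p : unitInterval) :
    MeasurePreserving (SiteConfig.relabel e) (sitePercolation V p) (sitePercolation W p) :=
  ⟨(SiteConfig.relabel e).measurable, sitePercolation_map_relabel e p⟩

/-- `ΦAB` preserves the pair of fair sign laws. [folklore] -/
theorem measurePreserving_ΦAB :
    MeasurePreserving ΦAB ((sitePercolation ℤ half).prod (sitePercolation ℤ half))
      ((sitePercolation ℤ half).prod (sitePercolation ℤ half)) := by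
  rw [ΦAB, MeasurableEquiv.coe_trans, MeasurableEquiv.coe_trans]
  exact measurePreserving_flipPair.comp
    (((measurePreserving_relabel (Equiv.neg ℤ) half).prod
      (MeasurePreserving.id (sitePercolation ℤ half))).comp Measure.measurePreserving_swap)

/-- The plaquette/coin part of `Φ`: `(Π, Π', C) ↦ (faceRot '' Π, Π', (faceRot '' C)ᶜ)`. [folklore] -/
def Φrest : Set (Site 2) × (Set (Site 2) × Set (Site 2)) ≃ᵐ Set (Site 2) × (Set (Site 2) × Set (Site 2)) :=
  MeasurableEquiv.prodCongr (SiteConfig.relabel faceRot)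
    (MeasurableEquiv.prodCongr (MeasurableEquiv.refl (Set (Site 2)))
      ((SiteConfig.relabel faceRot).trans (SiteConfig.complEquiv (Site 2))))

/-- Complementation invariance of the fair coin field. [folklore] -/
theorem measurePreserving_complEquiv_site :
    MeasurePreserving (SiteConfig.complEquiv (Site 2)) (sitePercolation (Site 2) half)
      (sitePercolation (Site 2) half) :=
  ⟨(SiteConfig.complEquiv (Site 2)).measurable, by
    rw [show ⇑(SiteConfig.complEquiv (Site 2)) = compl from rfl, sitePercolation_map_compl, symm_half]⟩

/-- `Φrest` preserves the law of (biased plaquettes, fair plaquettes, fair coins). [folklore] -/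
theorem measurePreserving_Φrest :
    MeasurePreserving Φrest
      ((sitePercolation (Site 2) (Set.projIcc (0:ℝ) 1 zero_le_one (2 * Real.sqrt 3 - 3))).prod
        ((sitePercolation (Site 2) half).prod (sitePercolation (Site 2) half)))
      ((sitePercolation (Site 2) (Set.projIcc (0:ℝ) 1 zero_le_one (2 * Real.sqrt 3 - 3))).prod
        ((sitePercolation (Site 2) half).prod (sitePercolation (Site 2) half))) := by
  refine (measurePreserving_relabel faceRot _).prod ((MeasurePreserving.id _).prod ?_)
  exact measurePreserving_complEquiv_site.comp (measurePreserving_relabel faceRot half)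

/-- THE BIT BIJECTION `Φ : Ω ≃ᵐ Ω` realising the quarter-turn on the gauge. [folklore] -/
def Φ : Ω ≃ᵐ Ω :=
  (MeasurableEquiv.prodAssoc.symm.trans (MeasurableEquiv.prodCongr ΦAB Φrest)).trans
    MeasurableEquiv.prodAssoc

/-- `Φ` preserves the gauge law `μIK`. [folklore] -/
theorem measurePreserving_Φ : MeasurePreserving Φ μIK μIK := by
  rw [Φ, MeasurableEquiv.coe_trans, MeasurableEquiv.coe_trans]
  unfold μIK
  exact (measurePreserving_prodAssoc _ _ _).comp
    ((measurePreserving_ΦAB.prod measurePreserving_Φrest).comp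
      ((measurePreserving_prodAssoc _ _ _).symm _))

/-- `Φ` in coordinates. [folklore] -/
theorem Φ_apply (ω : Ω) :
    Φ ω = ((flipPair (SiteConfig.relabel (Equiv.neg ℤ) ω.2.1, ω.1)).1,
      (flipPair (SiteConfig.relabel (Equiv.neg ℤ) ω.2.1, ω.1)).2,
      SiteConfig.relabel faceRot ω.2.2.1, ω.2.2.2.1, (SiteConfig.relabel faceRot ω.2.2.2.2)ᶜ) :=
  rfl

/-- Membership in the relabelled sign sequence `B ∘ neg`. [folklore] -/
theorem mem_relabel_neg (B : Set ℤ) (m : ℤ) : m ∈ SiteConfig.relabel (Equiv.neg ℤ) B ↔ -m ∈ B := by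
  rw [SiteConfig.mem_relabel_iff, Equiv.neg_symm, Equiv.neg_apply]

/-! ## §4 The colouring and the diagonals after `Φ` -/

/-- The number of plaquettes of `P` in the rectangle between `0` and `(a, b)`. [folklore] -/
def cnt (P : Set (Site 2)) (a b : ℤ) : ℕ :=
  ((Finset.Ico (min 0 a) (max 0 a) ×ˢ Finset.Ico (min 0 b) (max 0 b)).filter
    (fun f : ℤ × ℤ => ![f.1, f.2] ∈ P)).card

/-- Membership in the coordinate range of the rectangle between `0` and `a`. [folklore] -/
theorem mem_Ico_min_max (x a : ℤ) :
    x ∈ Finset.Ico (min 0 a) (max 0 a) ↔ (0 ≤ x ∧ x < a) ∨ (a ≤ x ∧ x < 0) := by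
  rw [Finset.mem_Ico]
  rcases le_total 0 a with h | h
  · rw [min_eq_left h, max_eq_right h]; omega
  · rw [min_eq_right h, max_eq_left h]; omega

/-- The reindexing `(x, y) ↦ (y, -x - 1)` of plaquette coordinates (`= faceRot⁻¹`). [folklore] -/
def cntEquiv : ℤ × ℤ ≃ ℤ × ℤ where
  toFun f := (f.2, -f.1 - 1)
  invFun f := (-f.2 - 1, f.1)
  left_inv f := Prod.ext (by dsimp only; omega) rfl
  right_inv f := Prod.ext rfl (by dsimp only; omega)

/-- The plaquette count of the relabelled field in the rectangle to `(a, b)` is the count of the field in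
the rotated rectangle, to `(b, -a)`. [folklore] -/
theorem cnt_preimage_faceRot (P : Set (Site 2)) (a b : ℤ) :
    cnt (faceRot.symm ⁻¹' P) a b = cnt P b (-a) := by
  unfold cnt
  refine Finset.card_equiv cntEquiv fun f => ?_
  simp only [Finset.mem_filter, Finset.mem_product, mem_Ico_min_max, mem_preimage, cntEquiv,
    Equiv.coe_fn_mk]
  have hf : faceRot.symm ![f.1, f.2] = ![f.2, -f.1 - 1] := by
    ext i; fin_cases i <;> simp only [Fin.zero_eta, Fin.mk_one, faceRot_symm_apply_zero, faceRot_symm_apply_one,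
      Matrix.cons_val_zero, Matrix.cons_val_one]
  rw [hf]
  constructor
  · rintro ⟨⟨h1, h2⟩, h3⟩; exact ⟨⟨h2, by omega⟩, h3⟩
  · rintro ⟨⟨h1, h2⟩, h3⟩; exact ⟨⟨by omega, h1⟩, h3⟩

/-- The plaquette-parity set of the all-isotropic pattern is the biased plaquette field. [folklore] -/
theorem parSet_univ (ω : Ω) : parSet Set.univ ω = ω.2.2.1 := by
  ext f; simp [parSet]

/-- The black cells of the all-isotropic pattern, through `cnt`. [folklore] -/
theorem mem_blackSet_univ (ω : Ω) (v : Site 2) :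
    v ∈ blackSet Set.univ ω ↔ Xor (v 0 ∈ ω.1) (Xor (v 1 ∈ ω.2.1) (Odd (cnt ω.2.2.1 (v 0) (v 1)))) := by
  simp only [blackSet, parSet_univ, mem_setOf_eq, cnt]

/-- Three-fold exclusive or is symmetric in its first two arguments. [folklore] -/
theorem xor_left_comm' (a b c : Prop) : Xor a (Xor b c) ↔ Xor b (Xor a c) := by
  simp only [xor_def]; tauto

/-- Negating the first two arguments of a three-fold exclusive or. [folklore] -/
theorem xor_not_xor_not (a b c : Prop) : Xor (¬a) (Xor (¬b) c) ↔ Xor a (Xor b c) := by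
  simp only [xor_def]; tauto

/-- BLACK CELLS ARE ROTATED: `v` is black after `Φ` iff `rot⁻¹ v` was black. [folklore] -/
theorem mem_blackSet_Φ (ω : Ω) (v : Site 2) :
    v ∈ blackSet Set.univ (Φ ω) ↔ rot.symm v ∈ blackSet Set.univ ω := by
  rw [mem_blackSet_univ, mem_blackSet_univ, Φ_apply]
  simp only [rot_symm_apply_zero, rot_symm_apply_one]
  rw [SiteConfig.relabel_apply faceRot, Equiv.image_eq_preimage_symm, cnt_preimage_faceRot]
  by_cases hc : (SiteConfig.relabel (Equiv.neg ℤ) ω.2.1, ω.1) ∈ oddPairs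
  · rw [flipPair, piecewise_eq_of_mem _ _ _ hc]
    simp only [Prod.map_fst, Prod.map_snd, mem_compl_iff, mem_relabel_neg]
    rw [xor_not_xor_not, xor_left_comm']
  · rw [flipPair, piecewise_eq_of_notMem _ _ _ hc]
    simp only [id_eq, mem_relabel_neg]
    rw [xor_left_comm']

/-- ANTI-DIAGONAL FACES ARE ROTATED AND FLIPPED: `f` carries the anti-diagonal after `Φ` iff the face
`faceRot⁻¹ f` carried the main diagonal. [folklore] -/
theorem mem_antiSet_Φ (ω : Ω) (f : Site 2) :
    f ∈ antiSet Set.univ (Φ ω) ↔ faceRot.symm f ∉ antiSet Set.univ ω := by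
  simp only [antiSet, Φ_apply, mem_univ, not_true_eq_false, false_or, mem_setOf_eq, mem_compl_iff,
    SiteConfig.mem_relabel_iff]

/-- The observables after `Φ`: rotated black cells, rotated-and-flipped diagonals. [folklore] -/
theorem obs_Φ (ω : Ω) :
    obs Set.univ (Φ ω) =
      (rot.symm ⁻¹' blackSet Set.univ ω, (faceRot.symm ⁻¹' antiSet Set.univ ω)ᶜ) := by
  unfold obs
  refine Prod.ext ?_ ?_
  · ext v; exact mem_blackSet_Φ ω v
  · ext f; exact mem_antiSet_Φ ω f

end Summit.CriticalPhenomena.CardyFormulaZ2.Theorems.IKQuarterTurn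

end
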